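import Mathlib
import Literature.AlgebraicGeometry.Resolution.LocalBlowup
import Summits.ResolutionOfSingularities.ResolutionOfSingularities.Theorems.FrobeniusClosingSteerClosedPointDictionary
import Summits.ResolutionOfSingularities.ResolutionOfSingularities.Theorems.FrobeniusClosingSteerSteeredMembersRegular
import HarnessLib

/-!
# Crux `Steer` (stmt-ResolutionOfSingularities-16345), line `switching_dichotomy` — the residue fields of the members are PERFECT

Helper for chain W4.1 (bridge announced in res-L0-w41-stub-2's 05:55:39Z line; consumers: the
closed-point dictionary `FrobeniusClosingSteerClosedPointDictionary.lean` p503434, whose converse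
direction asks for `PerfectField (ResidueField (R N))`, and every phase-machine piece whose docstring
says "when the residue field is perfect"). OURS — statements about the route's own objects; nothing
here is a statement of the manuscript under review.

**The fact.** Let `k` be a perfect field, `K ⊇ k` a field, `O` a valuation ring of `K` which is
ZERO-DIMENSIONAL over `k` in the sense of the core datum (`ZeroDim k O`: every `x ∈ O` satisfies
`f(x) ∈ 𝔪_O` for some non-zero `f ∈ k[X]`, i.e. the residue field of `O` is algebraic over `k`), and
`S ⊆ O` a local subring containing `k`. Then the residue field of `S` is algebraic over `k`, hence
PERFECT. (No domination hypothesis is needed: an element of `S` of value `< 1` is never a unit of `S`,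
because its inverse would lie outside `O`.) In particular this applies to every member
`R N = (A_N)_{𝔪_O ∩ A_N}` of the point sequence or of a σ_top-steered run of a core datum
(`perfectField_residueField_of_steps`), and the closed-point dictionary (p503434) becomes SKELETON-READY:
`exitAt_of_steeredExitAt_of_steps` / `isSingPrime_of_not_exitAt_of_steps` take only core-datum binders and
the run's steps (member regularity from `SteeredMembersRegular.isRegularLocalRing_steps`).
-/

-- The namespace mirrors the chain's helper layout (`…Theorems.SwitchingDichotomy.<Piece>`) on purpose.
set_option linter.dupNamespace false

noncomputable section

namespace Summit.ResolutionOfSingularities.ResolutionOfSingularities.Theorems.SwitchingDichotomy.MembersPerfectResidue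

open Polynomial IsLocalRing Literature.AlgebraicGeometry.Resolution

universe u

variable {K : Type u} [Field K]

/-- An element of a subring `S ⊆ O` of `O`-value `< 1` is not a unit of `S` (its inverse would have
value `> 1`, outside `O ⊇ S`). [folklore] -/
theorem not_isUnit_of_valuation_lt_one {O : ValuationSubring K} {S : Subring K}
    (hSO : S ≤ O.toSubring) {x : S} (hx : O.valuation (x : K) < 1) : ¬ IsUnit x := by
  intro hu
  obtain ⟨u, rfl⟩ := hu
  have hinv : O.valuation ((↑u⁻¹ : S) : K) ≤ 1 := (O.valuation_le_one_iff _).mpr (hSO (↑u⁻¹ : S).2)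
  have hmul : ((u : S) : K) * ((↑u⁻¹ : S) : K) = 1 := by
    rw [← Subring.coe_mul, Units.mul_inv, Subring.coe_one]
  have hle : O.valuation ((u : S) : K) * O.valuation ((↑u⁻¹ : S) : K) ≤ O.valuation ((u : S) : K) * 1 :=
    mul_le_mul' le_rfl hinv
  have hlt : O.valuation (((u : S) : K) * ((↑u⁻¹ : S) : K)) < 1 := by
    rw [map_mul]
    exact lt_of_le_of_lt hle (by rw [mul_one]; exact hx)
  rw [hmul, map_one] at hlt
  exact lt_irrefl _ hlt

/-- Hence an element of `S ⊆ O` (`S` local) of value `< 1` lies in the maximal ideal of `S`.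
[folklore] -/
theorem mem_maximalIdeal_of_valuation_lt_one {O : ValuationSubring K} {S : Subring K} [IsLocalRing S]
    (hSO : S ≤ O.toSubring) {x : S} (hx : O.valuation (x : K) < 1) : x ∈ maximalIdeal S :=
  (mem_maximalIdeal _).mpr (not_isUnit_of_valuation_lt_one hSO hx)

section Residue

variable {k : Type u} [Field k] [Algebra k K]

/-- `k → S → K` is the structure map of `K`. [folklore] -/
theorem subtype_comp_codRestrict (S : Subring K) (hkS : ∀ c : k, algebraMap k K c ∈ S) :
    S.subtype.comp ((algebraMap k K).codRestrict S hkS) = algebraMap k K :=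
  RingHom.ext fun _ => rfl

/-- **Every residue of `S` is algebraic over `k`** when `k ⊆ S ⊆ O` and `O` is zero-dimensional over
`k` (`ZeroDim k O` of the core datum, unfolded): the relation `f(x) ∈ 𝔪_O` of `x ∈ S` gives
`f(x) ∈ 𝔪_S` (value `< 1`, `S ⊆ O`), i.e. `f̄(x̄) = 0` in the residue field of `S`. Stated with the
algebra map written out (`eval₂` along `k → S → κ(S)`). [folklore] -/
theorem exists_eval₂_residue_eq_zero (O : ValuationSubring K) (S : Subring K) [IsLocalRing S]
    (hSO : S ≤ O.toSubring) (hkS : ∀ c : k, algebraMap k K c ∈ S)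
    (h0 : ∀ x ∈ O, ∃ f : Polynomial k, f ≠ 0 ∧ Polynomial.aeval x f ∈ O.nonunits)
    (a : ResidueField S) :
    ∃ f : Polynomial k, f ≠ 0 ∧ f.eval₂ ((residue S).comp ((algebraMap k K).codRestrict S hkS)) a = 0 := by
  obtain ⟨x, rfl⟩ := residue_surjective a
  obtain ⟨f, hf0, hfx⟩ := h0 (x : K) (hSO x.2)
  refine ⟨f, hf0, ?_⟩
  -- `f(x̄) = residue (f(x))`, and `f(x) ∈ 𝔪_S` since its value is `< 1`
  rw [← hom_eval₂, residue_eq_zero_iff]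
  refine mem_maximalIdeal_of_valuation_lt_one hSO ?_
  rw [← ValuationSubring.mem_nonunits_iff]
  have hco : ((f.eval₂ ((algebraMap k K).codRestrict S hkS) x : S) : K) = Polynomial.aeval (x : K) f := by
    rw [Polynomial.aeval_def]
    have h := Polynomial.hom_eval₂ f ((algebraMap k K).codRestrict S hkS) S.subtype x
    rw [subtype_comp_codRestrict] at h
    exact h
  rw [hco]
  exact hfx

/-- **The residue field of `S` is perfect** for a local subring `k ⊆ S ⊆ O` with `k` perfect and `O`
zero-dimensional over `k`: it is algebraic over `k` (`exists_eval₂_residue_eq_zero`), and algebraic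
extensions of perfect fields are perfect. Applies to every member `(A_N)_{𝔪_O ∩ A_N}` of the point
sequence or of a σ_top-steered run of a core datum. [folklore] -/
theorem perfectField_residueField [PerfectField k] (O : ValuationSubring K) (S : Subring K)
    [IsLocalRing S] (hSO : S ≤ O.toSubring) (hkS : ∀ c : k, algebraMap k K c ∈ S)
    (h0 : ∀ x ∈ O, ∃ f : Polynomial k, f ≠ 0 ∧ Polynomial.aeval x f ∈ O.nonunits) :
    PerfectField (ResidueField S) := by
  letI : Algebra k (ResidueField S) := ((residue S).comp ((algebraMap k K).codRestrict S hkS)).toAlgebra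
  haveI : Algebra.IsAlgebraic k (ResidueField S) := by
    refine ⟨fun a => ?_⟩
    obtain ⟨f, hf0, hf⟩ := exists_eval₂_residue_eq_zero O S hSO hkS h0 a
    exact ⟨f, hf0, by rw [Polynomial.aeval_def]; exact hf⟩
  exact Algebra.IsAlgebraic.perfectField k

/-- Run-member form: for `R : ℕ → Subring K` with `A₀ ⊆ R N ⊆ O` (`A₀` a `k`-subalgebra — so `k ⊆ R N`),
`R N` local, the residue field of `R N` is perfect. [folklore] -/
theorem perfectField_residueField_member [PerfectField k] (O : ValuationSubring K)
    (A₀ : Subalgebra k K) (R : ℕ → Subring K) (N : ℕ) [IsLocalRing (R N)]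
    (hA : A₀.toSubring ≤ R N) (hRO : R N ≤ O.toSubring)
    (h0 : ∀ x ∈ O, ∃ f : Polynomial k, f ≠ 0 ∧ Polynomial.aeval x f ∈ O.nonunits) :
    PerfectField (ResidueField (R N)) :=
  perfectField_residueField O (R N) hRO (fun c => hA (A₀.algebraMap_mem c)) h0

end Residue


/-! ## Along a tower of local blowings up: members contain `A₀`, lie in `O`, and have perfect residue fields -/

section Tower

variable {k : Type u} [Field k] [Algebra k K]

/-- Tower bookkeeping: along finitely many local blowings up (`IsLocalBlowupAlong`, NSp Def. 2.11)
starting at `R 0 = (A₀)_{𝔪_O ∩ A₀}`, every member contains `A₀` and lies in `O`. [folklore] -/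
theorem le_member_of_steps (O : ValuationSubring K) (A₀ : Subalgebra k K)
    (h₀ : A₀.toSubring ≤ O.toSubring) (R : ℕ → Subring K) (P : (i : ℕ) → Ideal (R i)) (N : ℕ)
    (hR0 : R 0 = locAtCentre A₀.toSubring O)
    (hstep : ∀ i < N, IsLocalBlowupAlong O (R i) (P i) (R (i + 1))) :
    ∀ i ≤ N, A₀.toSubring ≤ R i ∧ R i ≤ O.toSubring := by
  intro i hi
  induction i with
  | zero =>
    rw [hR0]
    exact ⟨le_locAtCentre _ O, locAtCentre_le h₀⟩
  | succ i ih =>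
    obtain ⟨hA, -⟩ := ih (Nat.le_of_succ_le hi)
    have hbl := (hstep i (Nat.lt_of_succ_le hi)).isLocalBlowup
    exact ⟨hA.trans hbl.le, hbl.target_le⟩

/-- **The residue field of every member of a tower of local blowings up of a core datum is PERFECT**
(`k` perfect, `ZeroDim k O` unfolded). [folklore] -/
theorem perfectField_residueField_of_steps [PerfectField k] (O : ValuationSubring K)
    (A₀ : Subalgebra k K) (h₀ : A₀.toSubring ≤ O.toSubring)
    (h0 : ∀ x ∈ O, ∃ f : Polynomial k, f ≠ 0 ∧ Polynomial.aeval x f ∈ O.nonunits)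
    (R : ℕ → Subring K) (P : (i : ℕ) → Ideal (R i)) (N : ℕ) [IsLocalRing (R N)]
    (hR0 : R 0 = locAtCentre A₀.toSubring O)
    (hstep : ∀ i < N, IsLocalBlowupAlong O (R i) (P i) (R (i + 1))) :
    PerfectField (ResidueField (R N)) := by
  obtain ⟨hA, hRO⟩ := le_member_of_steps O A₀ h₀ R P N hR0 hstep N le_rfl
  exact perfectField_residueField_member O A₀ R N hA hRO h0

/-- **Skeleton-ready dictionary, exit direction**: along a σ_top-steered run of a core datum (minimal
binders: `k` perfect of characteristic `p`, `ZeroDim k O`, regularity at the centre, the blow-up steps with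
their centre classes), if `s N` generates the torsor of `t` over `R N` (`GenAt`) and the germ at the closed
point of `R N` is regular (`SteeredExitAt`), then the phase machine exits at `R N` (`ExitAt`) — all four
predicates with their bodies unfolded (`ClosedPointDictionary.exitAt_of_steeredExitAt` with the perfectness
and the regularity of `R N` discharged from the run). [folklore] -/
theorem exitAt_of_steeredExitAt_of_steps (p : ℕ) [Fact p.Prime] [CharP k p] [PerfectField k]
    (O : ValuationSubring K) (A₀ : Subalgebra k K) (h₀ : A₀.toSubring ≤ O.toSubring) (t : K)
    (hreg : IsRegularLocalRing (Localization.AtPrime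
      (Ideal.comap (Subring.inclusion h₀) (IsLocalRing.maximalIdeal O))))
    (h0 : ∀ x ∈ O, ∃ f : Polynomial k, f ≠ 0 ∧ Polynomial.aeval x f ∈ O.nonunits)
    (R : ℕ → Subring K) (P : (i : ℕ) → Ideal (R i)) (s : ℕ → K) (N : ℕ) [IsLocalRing (R N)]
    (hR0 : R 0 = locAtCentre A₀.toSubring O)
    (hstep : ∀ i < N, ∃ _ : IsLocalRing (R i),
      (IsRegularLocalRing (R i ⧸ P i) ∨ P i = maximalIdeal (R i)) ∧
        IsLocalBlowupAlong O (R i) (P i) (R (i + 1)))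
    (hgen : s N ^ p ∈ R N ∧ t ∈ Subring.closure (insert (s N) (R N : Set K)))
    (hexit : ∃ (_ : IsLocalRing (R N)) (hs : s N ^ p ∈ R N),
      ¬ ¬ IsRegularLocalRing (AdjoinRoot ((X : (Localization.AtPrime (maximalIdeal (R N)))[X]) ^ p -
        C (algebraMap (R N) (Localization.AtPrime (maximalIdeal (R N))) ⟨s N ^ p, hs⟩)))) :
    ∃ s' : K, (s' ^ p ∈ R N ∧ t ∈ Subring.closure (insert s' (R N : Set K))) ∧
      ∃ g ∈ R N, ∃ (_ : IsLocalRing (R N)) (z : Fin 1 → R N),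
        IsRsopPart z ∧ ((z 0 : R N) : K) = s' ^ p - g ^ p := by
  haveI : CharP K p := charP_of_injective_algebraMap (algebraMap k K).injective p
  have hstep' : ∀ i < N, IsLocalBlowupAlong O (R i) (P i) (R (i + 1)) := fun i hi =>
    (hstep i hi).snd.2
  haveI : PerfectField (ResidueField (R N)) :=
    perfectField_residueField_of_steps O A₀ h₀ h0 R P N hR0 hstep'
  have hR0reg : IsRegularLocalRing (R 0) := by
    rw [hR0]
    exact (isRegularLocalRing_locAtCentre_iff h₀).mpr hreg
  have hregN : IsRegularLocalRing (R N) :=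
    SteeredMembersRegular.isRegularLocalRing_steps (O := O) R P N hR0reg hstep N le_rfl
  exact ClosedPointDictionary.exitAt_of_steeredExitAt p R s N t hregN hgen hexit

/-- **Skeleton-ready dictionary, singular direction**: with the same data, if `s N` generates the torsor of
`t` over `R N` and the phase machine does NOT exit at `R N`, then the germ at the closed point is singular
(`IsSingPrime (R N) p ((s N)^p) 𝔪`, unfolded). [folklore] -/
theorem isSingPrime_of_not_exitAt_of_steps (p : ℕ) [Fact p.Prime] [CharP k p] [PerfectField k]
    (O : ValuationSubring K) (A₀ : Subalgebra k K) (h₀ : A₀.toSubring ≤ O.toSubring) (t : K)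
    (hreg : IsRegularLocalRing (Localization.AtPrime
      (Ideal.comap (Subring.inclusion h₀) (IsLocalRing.maximalIdeal O))))
    (h0 : ∀ x ∈ O, ∃ f : Polynomial k, f ≠ 0 ∧ Polynomial.aeval x f ∈ O.nonunits)
    (R : ℕ → Subring K) (P : (i : ℕ) → Ideal (R i)) (s : ℕ → K) (N : ℕ) [IsLocalRing (R N)]
    (hR0 : R 0 = locAtCentre A₀.toSubring O)
    (hstep : ∀ i < N, ∃ _ : IsLocalRing (R i),
      (IsRegularLocalRing (R i ⧸ P i) ∨ P i = maximalIdeal (R i)) ∧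
        IsLocalBlowupAlong O (R i) (P i) (R (i + 1)))
    (hs : s N ^ p ∈ R N) (hgen : s N ^ p ∈ R N ∧ t ∈ Subring.closure (insert (s N) (R N : Set K)))
    (hne : ¬ ∃ s' : K, (s' ^ p ∈ R N ∧ t ∈ Subring.closure (insert s' (R N : Set K))) ∧
      ∃ g ∈ R N, ∃ (_ : IsLocalRing (R N)) (z : Fin 1 → R N),
        IsRsopPart z ∧ ((z 0 : R N) : K) = s' ^ p - g ^ p) :
    ¬ IsRegularLocalRing (AdjoinRoot ((X : (Localization.AtPrime (maximalIdeal (R N)))[X]) ^ p -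
      C (algebraMap (R N) (Localization.AtPrime (maximalIdeal (R N))) ⟨s N ^ p, hs⟩))) := by
  haveI : CharP K p := charP_of_injective_algebraMap (algebraMap k K).injective p
  have hstep' : ∀ i < N, IsLocalBlowupAlong O (R i) (P i) (R (i + 1)) := fun i hi =>
    (hstep i hi).snd.2
  haveI : PerfectField (ResidueField (R N)) :=
    perfectField_residueField_of_steps O A₀ h₀ h0 R P N hR0 hstep'
  have hR0reg : IsRegularLocalRing (R 0) := by
    rw [hR0]
    exact (isRegularLocalRing_locAtCentre_iff h₀).mpr hreg
  have hregN : IsRegularLocalRing (R N) :=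
    SteeredMembersRegular.isRegularLocalRing_steps (O := O) R P N hR0reg hstep N le_rfl
  exact ClosedPointDictionary.isSingPrime_of_not_exitAt p R s N t hregN hs hgen hne

end Tower

end Summit.ResolutionOfSingularities.ResolutionOfSingularities.Theorems.SwitchingDichotomy.MembersPerfectResidue

end
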